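import Summits.QuantumFields.GaugeBoot.ZdWordFreeReduction
import Summits.QuantumFields.GaugeBoot.BootstrapCertificateConeClosed
import Summits.QuantumFields.GaugeBoot.WordDerivative
import Summits.QuantumFields.GaugeBoot.WordLoop
import HarnessLib

/-!
# No Wilson loop is frozen: on every finite torus, at every coupling, `|⟨W_x(w)⟩_β| < 1` unless the word is null-homotopic (gauge-boot, large-`N` supplement 16, part 10)

HONEST FRAMING (cell `pub-gaugeboot`, page 1 of every file): the venture produces certified bounds
on lattice expectations at stated coupling, gauge group, dimension and torus size; NOT a mass gap,
NOT a continuum limit, NOT a string tension; NOT large `N` unless marked CONDITIONAL; NOT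
Yang–Mills-summit-bearing (barriers `FixedCouplingUltralocality`, `PerturbativeInvisibility`).
A qualitative STRICT inequality for the cell's own objects (torus Wilson states of `SU(N)`); it
certifies no number.

## Content

The free configuration descends to every torus `(ℤ/L)^d` (it is translation invariant), so the word
calculus of parts 2–9 applies to the torus holonomy `wordHolonomy` of `LatticeWords.lean`:

* `freeTorusConfigOf φ`, `wordHolonomy_freeTorusConfigOf` (`hol_x(w) = φ(mk (code w))`), ★
  `wordHolonomy_freeTorusConfigOf_eq_one_iff` — for injective `φ`, `hol_x(w)(U_free) = 1` iff the word
  freely reduces to nothing (`Word.freeReduce`, `LoopClasses.lean`);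
* `continuous_wordLoop`, `wordLoop_suRep_torus_eq_one_iff` (`W = 1 ⟺ hol = 1` for `SU(N)`);
* ★★★ `wilsonExpectation_wordLoop_lt_one` — **`SU(N)`, `N ≥ 2`, every `d`, every torus size `L`, EVERY
  real `β`, every base point and every word whose free reduction is non-empty: `⟨W_x(w)⟩_{β,L} < 1`
  STRICTLY** (the Wilson measure charges every open set — the lane's `isOpenPosMeasure_wilsonMeasure` —
  and `1 − W` is continuous, `≥ 0`, and positive at the free configuration); `wilsonExpectation_wordLoop_gt_neg_one`
  (`> −1`, `N ≥ 1`, every word: `1 + W > 0` at the trivial configuration); ★★★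
  `wilsonExpectation_wordLoop_eq_one_iff` — **`⟨W_x(w)⟩_{β,L} = 1` iff `w` freely reduces to the empty word**;
* ★★ `plaquetteExpectation_lt_one` — in the cell's own vocabulary (`Targets.lean`): the torus-averaged
  plaquette satisfies `⟨ū_P⟩_{(ℤ/L)^D, SU(N), β_std} < 1` for every `N ≥ 2`, `D`, `L`, `β_std` — the
  certified upper bounds `b < 1` of the cell are bounds on a quantity that never saturates.

NOT claimed: any rate (how far below `1`), anything uniform in `L` or `β`, infinite volume.  [folklore].
-/

noncomputable section

open MeasureTheory
open Literature.MathematicalPhysics.QuantumFieldTheory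
open Literature.MathematicalPhysics.QuantumLattice (fundamentalLatticeRep)
open Literature.RepresentationTheory.CompactGroups

namespace Summit.QuantumFields.GaugeBoot

variable {d L : ℕ}

/-! ## The free configuration on the torus -/

section FreeTorus

variable {G : Type*} [Group G]

/-- **The free torus configuration of `φ : FreeGroup ℕ →* G`**: every link of axis `μ` carries `φ (of μ)`. [folklore] -/
def freeTorusConfigOf (d L : ℕ) (φ : FreeGroup ℕ →* G) : GaugeConfig d L G := fun e => φ (FreeGroup.of e.2.val)

/-- A step's torus holonomy on the free configuration. [folklore] -/
theorem stepHolonomy_freeTorusConfigOf (φ : FreeGroup ℕ →* G) (x : Site d L) (s : Step d) :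
    stepHolonomy (freeTorusConfigOf d L φ) x s = φ (FreeGroup.mk [stepCode s]) := by
  cases s with
  | fwd μ => rfl
  | bwd μ =>
    rw [stepHolonomy_bwd, freeTorusConfigOf, ← map_inv]
    rfl

/-- **A word's torus holonomy on the free configuration is `φ` of its `FreeGroup ℕ` word** (any base point,
closed or not, wrapping or not). [folklore] -/
theorem wordHolonomy_freeTorusConfigOf (φ : FreeGroup ℕ →* G) : ∀ (x : Site d L) (w : Word d),
    wordHolonomy (freeTorusConfigOf d L φ) x w = φ (FreeGroup.mk (w.map stepCode))
  | x, [] => by rw [wordHolonomy_nil, List.map_nil, ← FreeGroup.one_eq_mk, map_one]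
  | x, s :: w => by
    rw [wordHolonomy_cons, wordHolonomy_freeTorusConfigOf φ (s.apply x) w, stepHolonomy_freeTorusConfigOf, ← map_mul,
      FreeGroup.mul_mk, List.map_cons, List.singleton_append]

/-- ★ **On the free torus configuration of an injective `φ`, `hol_x(w) = 1` iff `w` freely reduces to nothing.**
[folklore] -/
theorem wordHolonomy_freeTorusConfigOf_eq_one_iff {φ : FreeGroup ℕ →* G} (hφ : Function.Injective φ) (x : Site d L) (w : Word d) :
    wordHolonomy (freeTorusConfigOf d L φ) x w = 1 ↔ Word.freeReduce w = [] := by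
  rw [← wordHolonomy_freeReduce (freeTorusConfigOf d L φ) w x, wordHolonomy_freeTorusConfigOf, ← map_one φ, hφ.eq_iff]
  constructor
  · intro h
    have hred := isReduced_map_stepCode (Word.isChain_freeReduce w)
    have h1 := congrArg FreeGroup.toWord h
    rw [FreeGroup.toWord_mk, hred.reduce_eq, FreeGroup.toWord_one, List.map_eq_nil_iff] at h1
    exact h1
  · intro h
    rw [h, List.map_nil, FreeGroup.one_eq_mk]

end FreeTorus

/-! ## Loop variables on the torus -/

section SU

variable {N : ℕ}

/-- **The `SU(N)` torus loop variable equals `1` iff the holonomy is `1`** (`N ≥ 1`). [folklore] -/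
theorem wordLoop_suRep_torus_eq_one_iff (hN : N ≠ 0) (x : Site d L) (w : Word d) (U : GaugeConfig d L (SU N)) :
    wordLoop (suRep N) x w U = 1 ↔ wordHolonomy U x w = 1 := by
  have hN' : (N : ℝ) ≠ 0 := Nat.cast_ne_zero.2 hN
  rw [wordLoop_apply, ← re_trace_suRep_eq_iff, inv_mul_eq_iff_eq_mul₀ hN', mul_one]

/-- The `SU(N)` torus loop variable is continuous in the configuration. [folklore] -/
theorem continuous_wordLoop (x : Site d L) (w : Word d) : Continuous (wordLoop (d := d) (L := L) (suRep N) x w) := by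
  have h : wordLoop (d := d) (L := L) (suRep N) x w = fun U => (N : ℝ)⁻¹ * ((suRep N) (wordHolonomy U x w)).trace.re := by
    funext U; rfl
  rw [h]
  exact continuous_const.mul (Complex.continuous_re.comp
    (((continuous_suRep N).comp (continuous_wordHolonomy x w)).matrix_trace))

/-- The `SU(N)` torus loop variable is `≤ 1`. [folklore] -/
theorem wordLoop_suRep_le_one (x : Site d L) (w : Word d) (U : GaugeConfig d L (SU N)) : wordLoop (suRep N) x w U ≤ 1 :=
  (le_abs_self _).trans (abs_wordLoop_le_one (suRep N) (continuous_suRep N) x w U)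

/-- The `SU(N)` torus loop variable is `≥ -1`. [folklore] -/
theorem neg_one_le_wordLoop_suRep (x : Site d L) (w : Word d) (U : GaugeConfig d L (SU N)) : -1 ≤ wordLoop (suRep N) x w U :=
  (abs_le.1 (abs_wordLoop_le_one (suRep N) (continuous_suRep N) x w U)).1

/-! ## Strict inequalities for the torus Wilson state -/

variable [NeZero L]

/-- ★★★ **NO WILSON LOOP IS FROZEN.**  `SU(N)`, `N ≥ 2`, any `d`, any torus size `L`, ANY real `β`, any
base point `x`, any word `w` whose free reduction is non-empty: `⟨W_x(w)⟩_{β,L} < 1` STRICTLY. [folklore] -/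
theorem wilsonExpectation_wordLoop_lt_one (hN : 2 ≤ N) (β : ℝ) (x : Site d L) {w : Word d} (hw : Word.freeReduce w ≠ []) :
    wilsonExpectation (suRep N) β (wordLoop (d := d) (L := L) (suRep N) x w) < 1 := by
  haveI := isProbabilityMeasure_wilsonMeasure (d := d) (L := L) (G := SU N) (suRep N) (continuous_suRep N) β
  haveI : SecondCountableTopology (Matrix (Fin N) (Fin N) ℂ) := inferInstanceAs (SecondCountableTopology (Fin N → Fin N → ℂ))
  haveI : SecondCountableTopology (SU N) := Topology.IsEmbedding.subtypeVal.secondCountableTopology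
  haveI : IsProbabilityMeasure (wilsonMeasure (d := d) (L := L) (fundamentalLatticeRep N).ρ β) :=
    isProbabilityMeasure_wilsonMeasure (d := d) (L := L) _ (fundamentalLatticeRep N).continuous β
  haveI : (wilsonMeasure (d := d) (L := L) (suRep N) β).IsOpenPosMeasure :=
    isOpenPosMeasure_wilsonMeasure (d := d) (L := L) (fundamentalLatticeRep N) β
  obtain ⟨k, rfl⟩ := Nat.exists_eq_add_of_le hN
  -- the free torus configuration
  set φ : FreeGroup ℕ →* SU (2 + k) := (blockEmb k).comp (FreeGroup.lift FreeSU2.genNat) with hφdef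
  have hφ : Function.Injective φ := by
    rw [hφdef, MonoidHom.coe_comp]; exact (blockEmb_injective k).comp FreeSU2.lift_genNat_injective
  have hW0 : wordLoop (suRep (2 + k)) x w (freeTorusConfigOf d L φ) ≠ 1 := fun h =>
    hw ((wordHolonomy_freeTorusConfigOf_eq_one_iff hφ x w).1 ((wordLoop_suRep_torus_eq_one_iff (by omega) x w _).1 h))
  -- `1 - W` is continuous, integrable, non-negative and positive at the free configuration
  have hint : Integrable (wordLoop (suRep (2 + k)) x w) (wilsonMeasure (d := d) (L := L) (suRep (2 + k)) β) :=
    integrable_wordLoop (suRep (2 + k)) (continuous_suRep (2 + k)) β x w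
  have hpos : 0 < ∫ U, (1 - wordLoop (suRep (2 + k)) x w U) ∂(wilsonMeasure (d := d) (L := L) (suRep (2 + k)) β) :=
    integral_pos_of_integrable_nonneg_nonzero (x := freeTorusConfigOf d L φ) (continuous_const.sub (continuous_wordLoop x w))
      ((integrable_const 1).sub hint) (fun U => sub_nonneg.2 (wordLoop_suRep_le_one x w U)) (sub_ne_zero.2 (Ne.symm hW0))
  rw [integral_sub (integrable_const 1) hint, integral_const, smul_eq_mul, mul_one, probReal_univ] at hpos
  rw [wilsonExpectation]
  linarith

/-- **`⟨W_x(w)⟩_{β,L} > −1`** for every word (`N ≥ 1`; `1 + W` is positive at the trivial configuration). [folklore] -/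
theorem wilsonExpectation_wordLoop_gt_neg_one (hN : N ≠ 0) (β : ℝ) (x : Site d L) (w : Word d) :
    -1 < wilsonExpectation (suRep N) β (wordLoop (d := d) (L := L) (suRep N) x w) := by
  haveI := isProbabilityMeasure_wilsonMeasure (d := d) (L := L) (G := SU N) (suRep N) (continuous_suRep N) β
  haveI : SecondCountableTopology (Matrix (Fin N) (Fin N) ℂ) := inferInstanceAs (SecondCountableTopology (Fin N → Fin N → ℂ))
  haveI : SecondCountableTopology (SU N) := Topology.IsEmbedding.subtypeVal.secondCountableTopology
  haveI : IsProbabilityMeasure (wilsonMeasure (d := d) (L := L) (fundamentalLatticeRep N).ρ β) :=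
    isProbabilityMeasure_wilsonMeasure (d := d) (L := L) _ (fundamentalLatticeRep N).continuous β
  haveI : (wilsonMeasure (d := d) (L := L) (suRep N) β).IsOpenPosMeasure :=
    isOpenPosMeasure_wilsonMeasure (d := d) (L := L) (fundamentalLatticeRep N) β
  have hW1 : wordLoop (suRep N) x w (fun _ => (1 : SU N)) = 1 := by
    rw [wordLoop_suRep_torus_eq_one_iff hN]
    clear hN
    induction w generalizing x with
    | nil => rfl
    | cons s w ih => rw [wordHolonomy_cons, ih]; cases s <;> simp
  have hint : Integrable (wordLoop (suRep N) x w) (wilsonMeasure (d := d) (L := L) (suRep N) β) :=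
    integrable_wordLoop (suRep N) (continuous_suRep N) β x w
  have hpos : 0 < ∫ U, (1 + wordLoop (suRep N) x w U) ∂(wilsonMeasure (d := d) (L := L) (suRep N) β) :=
    integral_pos_of_integrable_nonneg_nonzero (x := fun _ => (1 : SU N)) (continuous_const.add (continuous_wordLoop x w))
      ((integrable_const 1).add hint) (fun U => by have := neg_one_le_wordLoop_suRep x w U; simp only [Pi.zero_apply]; linarith)
      (by rw [hW1]; norm_num)
  rw [integral_add (integrable_const 1) hint, integral_const, smul_eq_mul, mul_one, probReal_univ] at hpos
  rw [wilsonExpectation]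
  linarith

/-- ★★★ **`⟨W_x(w)⟩_{β,L} = 1` iff the word freely reduces to the empty word** (`SU(N)`, `N ≥ 2`, every `d`,
`L`, `β`, `x`). [folklore] -/
theorem wilsonExpectation_wordLoop_eq_one_iff (hN : 2 ≤ N) (β : ℝ) (x : Site d L) (w : Word d) :
    wilsonExpectation (suRep N) β (wordLoop (d := d) (L := L) (suRep N) x w) = 1 ↔ Word.freeReduce w = [] := by
  refine ⟨fun h => ?_, fun h => ?_⟩
  · by_contra hw
    exact (wilsonExpectation_wordLoop_lt_one hN β x hw).ne h
  · haveI := isProbabilityMeasure_wilsonMeasure (d := d) (L := L) (G := SU N) (suRep N) (continuous_suRep N) β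
    rw [← wordLoop_freeReduce (suRep N) x w, h, wordLoop_nil (suRep N) (by omega), wilsonExpectation, integral_const, smul_eq_mul,
      mul_one, probReal_univ]

/-- Hence `|⟨W_x(w)⟩_{β,L}| < 1` for every word with non-empty free reduction (`N ≥ 2`). [folklore] -/
theorem abs_wilsonExpectation_wordLoop_lt_one (hN : 2 ≤ N) (β : ℝ) (x : Site d L) {w : Word d} (hw : Word.freeReduce w ≠ []) :
    |wilsonExpectation (suRep N) β (wordLoop (d := d) (L := L) (suRep N) x w)| < 1 :=
  abs_lt.2 ⟨wilsonExpectation_wordLoop_gt_neg_one (by omega) β x w, wilsonExpectation_wordLoop_lt_one hN β x hw⟩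

/-! ## The cell's object: the plaquette never saturates -/

omit [NeZero L] in
/-- The plaquette variable is the loop variable of the plaquette word. [folklore] -/
theorem plaquetteTrace_eq_wordLoop (x : Site d L) (i j : Fin d) :
    plaquetteTrace (d := d) (L := L) (suRep N) x i j = wordLoop (suRep N) x (Word.plaquette i j) := by
  funext U
  rw [plaquetteTrace, wordLoop_apply, wordHolonomy_plaquette]

omit [NeZero L] in
/-- The plaquette word of two distinct axes is reduced (indeed cyclically reduced) and non-empty. [folklore] -/
theorem freeReduce_plaquette_ne_nil {i j : Fin d} (hij : i ≠ j) : Word.freeReduce (Word.plaquette i j : Word d) ≠ [] := by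
  rw [Word.freeReduce_eq_self_of_isChain]
  · simp [Word.plaquette]
  · simp [Word.plaquette, Step.inv, hij]

/-- ★★ **Every single plaquette: `⟨u_P⟩_{β,L} < 1`** (`SU(N)`, `N ≥ 2`, any `d`, `L`, `β`, axes `i ≠ j`). [folklore] -/
theorem wilsonExpectation_plaquetteTrace_lt_one (hN : 2 ≤ N) (β : ℝ) (x : Site d L) {i j : Fin d} (hij : i ≠ j) :
    wilsonExpectation (suRep N) β (plaquetteTrace (d := d) (L := L) (suRep N) x i j) < 1 := by
  rw [plaquetteTrace_eq_wordLoop]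
  exact wilsonExpectation_wordLoop_lt_one hN β x (freeReduce_plaquette_ne_nil hij)

omit [NeZero L] in
/-- The torus-averaged plaquette is continuous. [folklore] -/
theorem continuous_meanPlaquette [NeZero L] : Continuous (meanPlaquette (d := d) (L := L) (suRep N)) := by
  have h : meanPlaquette (d := d) (L := L) (suRep N) =
      fun U => (Fintype.card (Plaquette d L) : ℝ)⁻¹ * ∑ p : Plaquette d L, wordLoop (suRep N) p.1 (Word.plaquette p.2.1.1 p.2.1.2) U := by
    funext U
    simp only [meanPlaquette, plaquetteTrace_eq_wordLoop]
  rw [h]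
  exact continuous_const.mul (continuous_finsetSum _ fun p _ => continuous_wordLoop _ _)

/-- ★★ **The torus-averaged plaquette never saturates: `⟨ū_P⟩_{(ℤ/L)^D, SU(N), β_std} < 1`** for every
`N ≥ 2`, `D`, `L ≥ 1`, `β_std` (the cell's `plaquetteExpectation`). [folklore] -/
theorem plaquetteExpectation_lt_one {D : ℕ} (hN : 2 ≤ N) (L : ℕ) [NeZero L] (β : ℝ) : plaquetteExpectation N D L β < 1 := by
  rw [plaquetteExpectation]
  set βt := β / N
  haveI := isProbabilityMeasure_wilsonMeasure (d := D) (L := L) (G := SU N) (suRep N) (continuous_suRep N) βt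
  haveI : SecondCountableTopology (Matrix (Fin N) (Fin N) ℂ) := inferInstanceAs (SecondCountableTopology (Fin N → Fin N → ℂ))
  haveI : SecondCountableTopology (SU N) := Topology.IsEmbedding.subtypeVal.secondCountableTopology
  haveI : IsProbabilityMeasure (wilsonMeasure (d := D) (L := L) (fundamentalLatticeRep N).ρ βt) :=
    isProbabilityMeasure_wilsonMeasure (d := D) (L := L) _ (fundamentalLatticeRep N).continuous βt
  haveI : (wilsonMeasure (d := D) (L := L) (suRep N) βt).IsOpenPosMeasure :=
    isOpenPosMeasure_wilsonMeasure (d := D) (L := L) (fundamentalLatticeRep N) βt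
  obtain ⟨k, rfl⟩ := Nat.exists_eq_add_of_le hN
  set φ : FreeGroup ℕ →* SU (2 + k) := (blockEmb k).comp (FreeGroup.lift FreeSU2.genNat) with hφdef
  have hφ : Function.Injective φ := by
    rw [hφdef, MonoidHom.coe_comp]; exact (blockEmb_injective k).comp FreeSU2.lift_genNat_injective
  set U₀ : GaugeConfig D L (SU (2 + k)) := freeTorusConfigOf D L φ
  have hle : ∀ U, meanPlaquette (d := D) (L := L) (suRep (2 + k)) U ≤ 1 := fun U =>
    (le_abs_self _).trans (abs_meanPlaquette_le_one (suRep (2 + k)) (continuous_suRep (2 + k)) U)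
  -- at the free configuration every plaquette variable is `< 1`, hence so is their mean (or there are none)
  have hlt : meanPlaquette (d := D) (L := L) (suRep (2 + k)) U₀ ≠ 1 := by
    intro h1
    rw [meanPlaquette] at h1
    rcases isEmpty_or_nonempty (Plaquette D L) with hE | hE
    · simp at h1
    · have hcard : (0 : ℝ) < Fintype.card (Plaquette D L) := by exact_mod_cast Fintype.card_pos
      have hsum : ∑ p : Plaquette D L, plaquetteTrace (suRep (2 + k)) p.1 p.2.1.1 p.2.1.2 U₀ <
          ∑ _p : Plaquette D L, (1 : ℝ) := by
        refine Finset.sum_lt_sum_of_nonempty Finset.univ_nonempty fun p _ => ?_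
        rw [plaquetteTrace_eq_wordLoop]
        refine lt_of_le_of_ne (wordLoop_suRep_le_one _ _ _) fun h => ?_
        exact freeReduce_plaquette_ne_nil (ne_of_lt p.2.2)
          ((wordHolonomy_freeTorusConfigOf_eq_one_iff hφ _ _).1 ((wordLoop_suRep_torus_eq_one_iff (by omega) _ _ _).1 h))
      rw [Finset.sum_const, Finset.card_univ, nsmul_eq_mul, mul_one] at hsum
      have : (Fintype.card (Plaquette D L) : ℝ)⁻¹ * ∑ p : Plaquette D L, plaquetteTrace (suRep (2 + k)) p.1 p.2.1.1 p.2.1.2 U₀ < 1 := by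
        rw [inv_mul_lt_iff₀ hcard, mul_one]; exact hsum
      exact this.ne h1
  have hint : Integrable (meanPlaquette (d := D) (L := L) (suRep (2 + k))) (wilsonMeasure (d := D) (L := L) (suRep (2 + k)) βt) :=
    Integrable.of_bound (measurable_meanPlaquette (suRep (2 + k)) (continuous_suRep (2 + k))).aestronglyMeasurable 1
      (ae_of_all _ fun U => by rw [Real.norm_eq_abs]; exact abs_meanPlaquette_le_one (suRep (2 + k)) (continuous_suRep (2 + k)) U)
  have hpos : 0 < ∫ U, (1 - meanPlaquette (d := D) (L := L) (suRep (2 + k)) U) ∂(wilsonMeasure (d := D) (L := L) (suRep (2 + k)) βt) :=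
    integral_pos_of_integrable_nonneg_nonzero (x := U₀) (continuous_const.sub continuous_meanPlaquette)
      ((integrable_const 1).sub hint) (fun U => sub_nonneg.2 (hle U)) (sub_ne_zero.2 (Ne.symm hlt))
  rw [integral_sub (integrable_const 1) hint, integral_const, smul_eq_mul, mul_one, probReal_univ] at hpos
  rw [wilsonExpectation]
  linarith

end SU

end Summit.QuantumFields.GaugeBoot

end
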